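import Mathlib
import Literature.NumberTheory.LFunctions.Zhang2022.SkeletonPartThree
import Literature.NumberTheory.LFunctions.Zhang2022.TypedAppendixB
import Literature.NumberTheory.LFunctions.Zhang2022.AppendixBLemma151Circles

/-!
# Zhang (2022) Appendix B, proof of Lemma 15.1, `μ = 2`: "the residue at `s = β₇` is, by the Cauchy
# integral formula, …" — `Typed.AppendixB.StepB_u011a` DISCHARGED exactly

Topic `Literature/NumberTheory/LFunctions/Zhang2022` (Landau–Siegel audit tree; verdict-neutral).
Y. Zhang, *Discrete mean estimates and the Landau–Siegel zero*, arXiv:2211.02515v1 (2022)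
[Zhang2022LandauSiegel] — **an unrefereed manuscript under adjudication.** Cell siegel-zhang
(D-0069), DISCHARGE row D16 (Lemma 15.1), DAG node `Z22:§B.u011` (first line) [Z22 p.107, tex
L5304–5307]: "the residue at `s = β₇` is, by the Cauchy integral formula,
`ζ(1+β₇)/ζ(1+β₇−β_j)·(log(P₂/l₁)/log P₂)(P₂/l₁)^{β₇} + (1/log P₂)(P₂/l₁)^{β₇} d/ds[ζ(1+s)/ζ(1+s−β_j)]|_{s=β₇}`",
typed by L4-t10 as `StepB_u011a c′` (the residue as `(2πi)⁻¹∮_{|s−β₇|=α} intB2`, the right side as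
`resBeta2 c′ D j l₁`).

PROVED here: `stepB_u011a_holds : StepB_u011a c′` — for `D` large, every `j ∈ {1,2,3}`, `l₁ ≥ 1`.
By `AppendixBLemma151Circles.circleIntegrals_intB2` the circle integral is `−G(β₇)/β₇² + G′(β₇)/β₇`
with `G(s) = ζ₁(1+s)(s−β_j)ζ₁(1+s−β_j)⁻¹(P₂/l₁)ˢ/log P₂`; near `β₇` (away from `0` and `β_j`)
`G(s) = s·ζ(1+s)/ζ(1+s−β_j)·(P₂/l₁)ˢ/log P₂`, whose derivative at `β₇` (product rule, Mathlib's
`differentiableAt_riemannZeta`, `HasDerivAt.const_cpow`) gives exactly the printed expression.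

WHAT THIS IS NOT: the VALUE of this residue (`StepB_u011b`, "`= (1 − 2j/5 + 8j/(25πi))e^{5πi/4}
+ O(α₁)`"), the contour shift, Lemma 15.1, or any claim about Theorems 1–2 / Landau–Siegel zeros.
Reference: Y. Zhang, arXiv:2211.02515v1 (2022), App. B p. 107. [cite: Zhang2022LandauSiegel, App. B p.107]
-/

noncomputable section

open Complex Real Metric Set Filter Topology

namespace Literature.NumberTheory.LFunctions.Zhang2022.Skeleton

open Typed.AppendixB (zetaRatio kerB intB2 resZero2 resBeta2)

section ResBeta

variable (c' : ℝ)

/-- `L₀ ≤ log D` once `D ≥ ⌈exp L₀⌉₊`. [folklore] -/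
private theorem le_ell_of_ceil_exp_le'' {L₀ : ℝ} {D : ℕ} (hD : ⌈Real.exp L₀⌉₊ ≤ D) : L₀ ≤ ell D := by
  have h : Real.exp L₀ ≤ D := le_trans (Nat.le_ceil _) (by exact_mod_cast hD)
  exact (Real.le_log_iff_exp_le (lt_of_lt_of_le (Real.exp_pos _) h)).mpr h

/-- `G(s) = s·ζ(1+s)/ζ(1+s−β_j)·(P₂/l₁)ˢ/log P₂` for `s ≠ 0`, `s ≠ β_j`, `ζ₁(1+s−β_j) ≠ 0`
(`ζ(1+s) = s⁻¹ζ₁(1+s)`). [cite: Zhang2022LandauSiegel, App. B p.107] -/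
theorem G_eq_mul_zetaRatio (D j l₁ : ℕ) {s : ℂ} (hs0 : s ≠ 0) (hsb : s ≠ betaJ c' D j)
    (hz : riemannZeta₁ (1 + s - betaJ c' D j) ≠ 0) :
    riemannZeta₁ (1 + s) * (s - betaJ c' D j) * (riemannZeta₁ (1 + s - betaJ c' D j))⁻¹ *
        ((P2 D / l₁ : ℝ) : ℂ) ^ s / (Real.log (P2 D) : ℂ) =
      s * zetaRatio c' D j s * ((P2 D / l₁ : ℝ) : ℂ) ^ s / (Real.log (P2 D) : ℂ) := by
  have h1 : (1 : ℂ) + s ≠ 1 := fun h => hs0 (by linear_combination h)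
  have h2 : (1 : ℂ) + s - betaJ c' D j ≠ 1 := fun h => hsb (by linear_combination h)
  rw [zetaRatio, riemannZeta_eq_inv_sub_mul h1, riemannZeta_eq_inv_sub_mul h2]
  have e1 : (1 : ℂ) + s - 1 = s := by ring
  have e2 : (1 : ℂ) + s - betaJ c' D j - 1 = s - betaJ c' D j := by ring
  rw [e1, e2]
  have hsb' : s - betaJ c' D j ≠ 0 := sub_ne_zero.mpr hsb
  field_simp

/-- **`StepB_u011a` holds**: the residue of `intB2` at the double pole `β₇`, as the circle integral
`(2πi)⁻¹∮_{|s−β₇|=α}`, equals the printed Cauchy-formula expression `resBeta2 c′ D j l₁`, for `D`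
large, `j ∈ {1,2,3}`, `l₁ ≥ 1`. DAG `Z22:§B.u011` (first line) DISCHARGED.
[cite: Zhang2022LandauSiegel, App. B p.107] -/
theorem stepB_u011a_holds : Typed.AppendixB.StepB_u011a c' := by
  obtain ⟨δ, hδ, K, hK, hζ⟩ := zeta1_near_one
  obtain ⟨D₀, hcirc⟩ := circleIntegrals_intB2 c'
  refine ⟨max D₀ (max 8 ⌈Real.exp (max (max 2 (60 * |c'| * π)) (max (10 * π / δ) (8 * K * π)))⌉₊),
    fun D _ χ hD hq hp j hj l₁ hl₁ => ?_⟩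
  obtain ⟨-, -, h7⟩ := hcirc D (le_trans (le_max_left _ _) hD) j hj l₁ hl₁
  obtain ⟨hℓ2, hc, hδα, -, hα0, -, hLlow⟩ := large_package c' hδ hK
    (le_ell_of_ceil_exp_le'' (le_trans (le_max_right _ _) (le_trans (le_max_right _ _) hD)))
  obtain ⟨-, hb4, -, hb7, hn7⟩ := betaJ_size c' hℓ2 hc hj
  rw [h7]
  -- notation and basic facts
  set b := betaJ c' D j with hb
  set β := beta7 D with hβ
  set Lc : ℂ := (Real.log (P2 D) : ℂ) with hLc
  have hL0 : 0 < Real.log (P2 D) := lt_of_lt_of_le (by positivity) hLlow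
  have hLc0 : Lc ≠ 0 := by rw [hLc]; exact_mod_cast hL0.ne'
  have hx : 0 < P2 D / l₁ := by
    have : 0 < P2 D := by
      rw [P2]; exact div_pos (Real.rpow_pos_of_pos (Real.exp_pos _) _) (pow_pos (Real.exp_pos _) _)
    have hl : (0 : ℝ) < l₁ := by exact_mod_cast hl₁
    positivity
  set x : ℂ := ((P2 D / l₁ : ℝ) : ℂ) with hxdef
  have hx0 : x ≠ 0 := by rw [hxdef]; exact_mod_cast hx.ne'
  have hβ0 : β ≠ 0 := by intro h; rw [h, norm_zero] at hn7; linarith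
  have hβb : β ≠ b := by
    intro h; rw [h, sub_self, norm_zero] at hb7; linarith
  -- `ζ₁(1 + s − β_j) ≠ 0` near `β`, and the two `ζ`-points are `≠ 1`
  have hzU : ∀ s : ℂ, ‖s‖ < 6 * alpha D → riemannZeta₁ (1 + s - b) ≠ 0 := by
    intro s hs
    have : ‖s - b‖ ≤ δ := by
      calc ‖s - b‖ ≤ ‖s‖ + ‖b‖ := norm_sub_le _ _
        _ ≤ 6 * alpha D + 4 * alpha D := by linarith
        _ ≤ δ := by linarith
    have := (hζ (s - b) this).2.2
    rwa [show (1 : ℂ) + (s - b) = 1 + s - b by ring] at this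
  have hβnorm : ‖β‖ < 6 * alpha D := by rw [hn7]; linarith
  -- the local identity `G = H` near `β`
  set G : ℂ → ℂ := fun s =>
    riemannZeta₁ (1 + s) * (s - b) * (riemannZeta₁ (1 + s - b))⁻¹ * x ^ s / Lc with hG
  set H : ℂ → ℂ := fun s => s * zetaRatio c' D j s * x ^ s / Lc with hH
  have hopen : IsOpen {s : ℂ | s ≠ 0 ∧ s ≠ b ∧ ‖s‖ < 6 * alpha D} := by
    refine (isOpen_ne.inter (isOpen_ne.inter ?_))
    exact isOpen_lt continuous_norm continuous_const
  have hmem : β ∈ {s : ℂ | s ≠ 0 ∧ s ≠ b ∧ ‖s‖ < 6 * alpha D} := ⟨hβ0, hβb, hβnorm⟩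
  have hGH : G =ᶠ[𝓝 β] H := by
    refine Filter.eventuallyEq_of_mem (hopen.mem_nhds hmem) fun s hs => ?_
    simp only [hG, hH]
    exact G_eq_mul_zetaRatio c' D j l₁ hs.1 hs.2.1 (hzU s hs.2.2)
  have hGβ : G β = β * zetaRatio c' D j β * x ^ β / Lc := hGH.self_of_nhds
  -- differentiability of `zetaRatio` at `β`
  have h1ne : (1 : ℂ) + β ≠ 1 := fun h => hβ0 (by linear_combination h)
  have h2ne : (1 : ℂ) + β - b ≠ 1 := fun h => hβb (by linear_combination h)
  have hden : riemannZeta (1 + β - b) ≠ 0 := by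
    rw [riemannZeta_eq_inv_sub_mul h2ne, show (1 : ℂ) + β - b - 1 = β - b by ring]
    exact mul_ne_zero (inv_ne_zero (sub_ne_zero.mpr hβb)) (hzU β hβnorm)
  have hzr_eq : zetaRatio c' D j = fun s => riemannZeta (1 + s) / riemannZeta (1 + s - b) := rfl
  have hzrd : DifferentiableAt ℂ (zetaRatio c' D j) β := by
    rw [hzr_eq]
    refine DifferentiableAt.div ?_ ?_ hden
    · exact (differentiableAt_riemannZeta h1ne).comp β (differentiableAt_id.const_add _)
    · exact (differentiableAt_riemannZeta h2ne).comp β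
        ((differentiableAt_id.const_add _).sub_const _)
  have hzr : HasDerivAt (zetaRatio c' D j) (deriv (zetaRatio c' D j) β) β := hzrd.hasDerivAt
  have hW : HasDerivAt (fun s : ℂ => x ^ s) (x ^ β * Complex.log x) β := by
    simpa using (hasDerivAt_id β).const_cpow (Or.inl hx0)
  have hHd : HasDerivAt H
      (((1 * zetaRatio c' D j β + β * deriv (zetaRatio c' D j) β) * x ^ β +
        β * zetaRatio c' D j β * (x ^ β * Complex.log x)) / Lc) β := by
    have := (((hasDerivAt_id β).mul hzr).mul hW).div_const Lc
    simpa [hH] using this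
  have hderiv : deriv G β = ((1 * zetaRatio c' D j β + β * deriv (zetaRatio c' D j) β) * x ^ β +
        β * zetaRatio c' D j β * (x ^ β * Complex.log x)) / Lc := by
    rw [hGH.deriv_eq]; exact hHd.deriv
  have hlogx : Complex.log x = ((Real.log (P2 D / l₁) : ℝ) : ℂ) := by
    rw [hxdef, Complex.ofReal_log hx.le]
  rw [hderiv, hGβ, resBeta2, hlogx]
  simp only [← hβ, ← hxdef]
  push_cast
  rw [← hLc]
  field_simp
  ring

/-- `StepB_u011a` — `_holds` alias of `stepB_u011a_holds` above under the fact's exact name (appended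
2026-08-28, D-0026 bookkeeping: the proof term is the existing theorem of this file; no statement,
definition or attribute is edited; no new named fact; the ledger's debt table listed the fact
unproved). [cite: Zhang2022LandauSiegel, App. B p.107] -/
theorem _root_.Literature.NumberTheory.LFunctions.Zhang2022.Typed.AppendixB.StepB_u011a_holds :
    Typed.AppendixB.StepB_u011a c' :=
  _root_.Literature.NumberTheory.LFunctions.Zhang2022.Skeleton.stepB_u011a_holds (c' := c')

end ResBeta

end Literature.NumberTheory.LFunctions.Zhang2022.Skeleton
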